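import Mathlib
import Summits.NavierStokesRegularity.NavierStokesRegularity.Theorems.L3TimeExponentPincerMorreyGrowth
import HarnessLib.Audit
import HarnessLib

/-!
# Ball averages of `C¹` vector fields on `ℝ³`: the segment estimate, the `L²` translation estimate and
# `‖f - A_ρ f‖₂ ≤ ρ ‖∇f‖₂`, `‖A_ρ f(x)‖² ≤ |B̄_ρ|⁻¹ ∫_{B̄(x,ρ)} |f|²`
# (route `L3TimeExponentPincer`, item `stmt-NavierStokesRegularity-19499`; support file 1/3 of
# "THEOREM J′ unconditional")

Support file (cell ns-regularity-ideate, seat p4, gen 4).  Pure real analysis on `ℝ³`, 0 `sorry`, no new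
definitions (the ball average `A_ρ f(x) = |B̄(0,ρ)|⁻¹ ∫_{B̄(0,ρ)} f(x+z) dz` is written out verbatim):

* `enorm_sub_sq_le_segment` : `‖f(x+z) - f(x)‖² ≤ ‖z‖² ∫₀¹ ‖Df(x + s z)‖² ds` (fundamental theorem of calculus on
  the segment + Cauchy–Schwarz);
* `lintegral_enorm_sub_translate_sq_le` : `‖f(· + z) - f‖₂² ≤ ‖z‖² ‖∇f‖₂²` (Tonelli + translation invariance);
* `lintegral_enorm_sub_ballAvg_sq_le` : `‖f - A_ρ f‖₂² ≤ ρ² ‖∇f‖₂²` (Jensen on the ball + the previous item);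
* `enorm_ballAvg_sq_le` : `‖A_ρ f(x)‖² ≤ |B̄_ρ|⁻¹ ∫_{B̄(x,ρ)} |f|²` (Jensen on the ball + translation).

Here `‖∇f‖₂² = ∫ ‖Df(x)‖ₑ²` with the operator norm of the Fréchet derivative (`≤` the Frobenius norm used by
`L3TimeExponentPincerJawFullMorrey.dissipRate`, via `sq_opNorm_le_frobeniusNormSq`).  These feed the elementary
interpolation inequality of `L3TimeExponentPincerMorreyInterpolation` which replaces Maz'ya's `W^{1,1}` trace
inequality (named fact `Literature.Analysis.FunctionSpaces.MazyaTraceD`, coarea/boxing — not in Mathlib) in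
THEOREM J′ of nsreg-p2 ROUND-9 (`L3TimeExponentPincerJawFullMorrey.jawUpToSix_of_mazya`).
References (textbook): E. M. Stein, *Singular Integrals and Differentiability Properties of Functions* (1970),
§V.3 (mollifier/translation estimates); standard.
-/

noncomputable section

namespace Summit.NavierStokesRegularity.NavierStokesRegularity.Theorems.L3TimeExponentPincerBallAverage

open MeasureTheory Set Function Filter Metric Topology
open scoped ENNReal NNReal
open Literature.Analysis.FluidPDE
open Summit.NavierStokesRegularity.NavierStokesRegularity.Theorems.L3TimeExponentPincerMorreyGrowth (V₁ V₁_nonneg volume_ball_eq)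

/-! ### §1  Elementary real analysis on `ℝ³` -/

/-- Cauchy–Schwarz against the constant `1`: `(∫ g)² ≤ μ(univ) · ∫ g²`. -/
theorem sq_lintegral_le {α : Type*} [MeasurableSpace α] (μ : Measure α) {g : α → ℝ≥0∞}
    (hg : AEMeasurable g μ) : (∫⁻ x, g x ∂μ) ^ 2 ≤ μ univ * ∫⁻ x, g x ^ 2 ∂μ := by
  have h := ENNReal.lintegral_mul_le_Lp_mul_Lq μ Real.HolderConjugate.two_two
    (f := fun _ => (1 : ℝ≥0∞)) aemeasurable_const hg
  simp only [Pi.mul_apply, one_mul, ENNReal.one_rpow, lintegral_const, one_div] at h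
  have h' : ∫⁻ x, g x ∂μ ≤ (μ univ) ^ (2 : ℝ)⁻¹ * (∫⁻ x, g x ^ (2 : ℝ) ∂μ) ^ (2 : ℝ)⁻¹ := by
    simpa only [mul_one] using h
  have h2 := pow_le_pow_left' h' 2
  refine h2.trans (le_of_eq ?_)
  rw [mul_pow, ← ENNReal.rpow_two ((μ univ) ^ (2 : ℝ)⁻¹), ← ENNReal.rpow_two ((∫⁻ x, g x ^ (2 : ℝ) ∂μ) ^ (2 : ℝ)⁻¹),
    ← ENNReal.rpow_mul, ← ENNReal.rpow_mul]
  norm_num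

/-- Translation of a set integral over a ball centred at `0` to the ball centred at `x`. -/
theorem setLIntegral_closedBall_add_left (g : (EuclideanSpace ℝ (Fin 3)) → ℝ≥0∞)
    (x : EuclideanSpace ℝ (Fin 3)) (ρ : ℝ) :
    ∫⁻ z in closedBall (0 : EuclideanSpace ℝ (Fin 3)) ρ, g (x + z) = ∫⁻ y in closedBall x ρ, g y := by
  rw [← lintegral_indicator measurableSet_closedBall, ← lintegral_indicator measurableSet_closedBall,
    ← lintegral_add_left_eq_self ((closedBall x ρ).indicator g) x]
  refine lintegral_congr fun z => ?_
  simp only [Set.indicator, mem_closedBall, dist_eq_norm, add_sub_cancel_left, sub_zero]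

/-- **Segment estimate.**  For a `C¹` map, `‖f(x+z) - f(x)‖² ≤ ‖z‖² ∫₀¹ ‖Df(x + s z)‖² ds`. -/
theorem enorm_sub_sq_le_segment {f : (EuclideanSpace ℝ (Fin 3)) → (EuclideanSpace ℝ (Fin 3))}
    (hf : ContDiff ℝ 1 f) (x z : EuclideanSpace ℝ (Fin 3)) :
    ‖f (x + z) - f x‖ₑ ^ 2 ≤
      ‖z‖ₑ ^ 2 * ∫⁻ s in Ioc (0 : ℝ) 1, ‖fderiv ℝ f (x + s • z)‖ₑ ^ 2 := by
  -- the path and its derivative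
  set φ : ℝ → EuclideanSpace ℝ (Fin 3) := fun s => f (x + s • z) with hφ
  set φ' : ℝ → EuclideanSpace ℝ (Fin 3) := fun s => fderiv ℝ f (x + s • z) z with hφ'
  have hdf : ∀ y, HasFDerivAt f (fderiv ℝ f y) y := fun y =>
    (hf.differentiable one_ne_zero).differentiableAt.hasFDerivAt
  have hderiv : ∀ s, HasDerivAt φ (φ' s) s := by
    intro s
    have h1 : HasDerivAt (fun s : ℝ => x + s • z) ((1 : ℝ) • z) s :=
      ((hasDerivAt_id s).smul_const z).const_add x
    have h2 : HasDerivAt φ ((fderiv ℝ f (x + s • z)) ((1 : ℝ) • z)) s :=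
      (hdf (x + s • z)).comp_hasDerivAt s h1
    rw [one_smul] at h2
    exact h2
  have hφ'c : Continuous φ' := by
    have : Continuous fun s : ℝ => fderiv ℝ f (x + s • z) :=
      (hf.continuous_fderiv one_ne_zero).comp (by fun_prop)
    exact this.clm_apply continuous_const
  have hFTC : ∫ s in (0:ℝ)..1, φ' s = f (x + z) - f x := by
    have h := intervalIntegral.integral_eq_sub_of_hasDerivAt (a := (0:ℝ)) (b := 1)
      (fun s _ => hderiv s) (hφ'c.intervalIntegrable 0 1)
    simpa only [hφ, one_smul, zero_smul, add_zero] using h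
  -- `‖f(x+z) - f x‖ ≤ ∫₀¹ ‖φ'‖ ≤ ‖z‖ ∫₀¹ ‖Df(x+sz)‖`
  have hpt : ∀ s, ‖φ' s‖ₑ ≤ ‖fderiv ℝ f (x + s • z)‖ₑ * ‖z‖ₑ := by
    intro s
    rw [hφ']
    simp only
    rw [← ofReal_norm, ← ofReal_norm, ← ofReal_norm, ← ENNReal.ofReal_mul (norm_nonneg _)]
    exact ENNReal.ofReal_le_ofReal (ContinuousLinearMap.le_opNorm _ _)
  have h1 : ‖f (x + z) - f x‖ₑ ≤ ‖z‖ₑ * ∫⁻ s in Ioc (0:ℝ) 1, ‖fderiv ℝ f (x + s • z)‖ₑ := by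
    rw [← hFTC, intervalIntegral.integral_of_le zero_le_one]
    calc ‖∫ s in Ioc (0:ℝ) 1, φ' s‖ₑ ≤ ∫⁻ s in Ioc (0:ℝ) 1, ‖φ' s‖ₑ := enorm_integral_le_lintegral_enorm _
      _ ≤ ∫⁻ s in Ioc (0:ℝ) 1, ‖fderiv ℝ f (x + s • z)‖ₑ * ‖z‖ₑ := lintegral_mono fun s => hpt s
      _ = ‖z‖ₑ * ∫⁻ s in Ioc (0:ℝ) 1, ‖fderiv ℝ f (x + s • z)‖ₑ := by
          rw [lintegral_mul_const'' _ (by fun_prop), mul_comm]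
  -- Cauchy–Schwarz on the unit interval
  have hmeas : AEMeasurable (fun s : ℝ => ‖fderiv ℝ f (x + s • z)‖ₑ) (volume.restrict (Ioc (0:ℝ) 1)) := by
    fun_prop
  have hCS := sq_lintegral_le (volume.restrict (Ioc (0:ℝ) 1)) hmeas
  rw [Measure.restrict_apply MeasurableSet.univ, univ_inter, Real.volume_Ioc, sub_zero,
    ENNReal.ofReal_one, one_mul] at hCS
  calc ‖f (x + z) - f x‖ₑ ^ 2
      ≤ (‖z‖ₑ * ∫⁻ s in Ioc (0:ℝ) 1, ‖fderiv ℝ f (x + s • z)‖ₑ) ^ 2 := pow_le_pow_left' h1 2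
    _ = ‖z‖ₑ ^ 2 * (∫⁻ s in Ioc (0:ℝ) 1, ‖fderiv ℝ f (x + s • z)‖ₑ) ^ 2 := mul_pow _ _ 2
    _ ≤ ‖z‖ₑ ^ 2 * ∫⁻ s in Ioc (0:ℝ) 1, ‖fderiv ℝ f (x + s • z)‖ₑ ^ 2 := by gcongr

/-- **Translation estimate in `L²`**: `‖f(· + z) - f‖₂² ≤ ‖z‖² ‖∇f‖₂²`. -/
theorem lintegral_enorm_sub_translate_sq_le {f : (EuclideanSpace ℝ (Fin 3)) → (EuclideanSpace ℝ (Fin 3))}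
    (hf : ContDiff ℝ 1 f) (z : EuclideanSpace ℝ (Fin 3)) :
    ∫⁻ x, ‖f (x + z) - f x‖ₑ ^ 2 ≤ ‖z‖ₑ ^ 2 * ∫⁻ x, ‖fderiv ℝ f x‖ₑ ^ 2 := by
  have hcont : Continuous fun p : (EuclideanSpace ℝ (Fin 3)) × ℝ => fderiv ℝ f (p.1 + p.2 • z) :=
    (hf.continuous_fderiv one_ne_zero).comp (by fun_prop)
  have hswap : ∫⁻ x, ∫⁻ s in Ioc (0:ℝ) 1, ‖fderiv ℝ f (x + s • z)‖ₑ ^ 2 =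
      ∫⁻ s in Ioc (0:ℝ) 1, ∫⁻ x, ‖fderiv ℝ f (x + s • z)‖ₑ ^ 2 := by
    refine lintegral_lintegral_swap ?_
    exact (hcont.measurable.enorm.pow_const 2).aemeasurable
  calc ∫⁻ x, ‖f (x + z) - f x‖ₑ ^ 2
      ≤ ∫⁻ x, ‖z‖ₑ ^ 2 * ∫⁻ s in Ioc (0:ℝ) 1, ‖fderiv ℝ f (x + s • z)‖ₑ ^ 2 :=
        lintegral_mono fun x => enorm_sub_sq_le_segment hf x z
    _ = ‖z‖ₑ ^ 2 * ∫⁻ x, ∫⁻ s in Ioc (0:ℝ) 1, ‖fderiv ℝ f (x + s • z)‖ₑ ^ 2 :=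
        lintegral_const_mul' _ _ (ENNReal.pow_ne_top enorm_ne_top)
    _ = ‖z‖ₑ ^ 2 * ∫⁻ s in Ioc (0:ℝ) 1, ∫⁻ x, ‖fderiv ℝ f (x + s • z)‖ₑ ^ 2 := by rw [hswap]
    _ = ‖z‖ₑ ^ 2 * ∫⁻ s in Ioc (0:ℝ) 1, ∫⁻ x, ‖fderiv ℝ f x‖ₑ ^ 2 := by
        congr 1
        refine lintegral_congr fun s => ?_
        exact lintegral_add_right_eq_self (fun y => ‖fderiv ℝ f y‖ₑ ^ 2) (s • z)
    _ = ‖z‖ₑ ^ 2 * ∫⁻ x, ‖fderiv ℝ f x‖ₑ ^ 2 := by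
        rw [setLIntegral_const, Real.volume_Ioc, sub_zero, ENNReal.ofReal_one, mul_one]


/-! ### §2  The ball average `A_ρ f(x) = |B̄_ρ|⁻¹ ∫_{B̄(0,ρ)} f(x+z) dz` -/

/-- `|B̄(x,r)| = V₁ r³` in `ℝ³`. -/
theorem volume_closedBall_eq (x : EuclideanSpace ℝ (Fin 3)) {r : ℝ} (hr : 0 < r) :
    volume (closedBall x r) = ENNReal.ofReal (r ^ 3 * V₁) := by
  rw [Measure.addHaar_closedBall volume x hr.le, finrank_euclideanSpace_fin, V₁,
    ENNReal.ofReal_mul (by positivity), ENNReal.ofReal_toReal measure_ball_lt_top.ne]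

/-- `0 < |B̄(x,r)|` and `|B̄(x,r)| < ∞` packaged as `≠`. -/
theorem volume_closedBall_ne_zero (x : EuclideanSpace ℝ (Fin 3)) {r : ℝ} (hr : 0 < r) :
    volume (closedBall x r) ≠ 0 :=
  (measure_closedBall_pos volume x hr).ne'

/-- Jensen/Cauchy–Schwarz for an average: `‖|K|⁻¹ ∫_K g‖² ≤ |K|⁻¹ ∫_K ‖g‖²`. -/
theorem enorm_avg_sq_le {K : Set (EuclideanSpace ℝ (Fin 3))} (hK0 : volume K ≠ 0) (hKtop : volume K ≠ ⊤)
    {g : (EuclideanSpace ℝ (Fin 3)) → (EuclideanSpace ℝ (Fin 3))} (hg : AEMeasurable g (volume.restrict K)) :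
    ‖(volume K).toReal⁻¹ • ∫ z in K, g z‖ₑ ^ 2 ≤ (volume K)⁻¹ * ∫⁻ z in K, ‖g z‖ₑ ^ 2 := by
  rw [enorm_smul, Real.enorm_of_nonneg (inv_nonneg.2 ENNReal.toReal_nonneg),
    ENNReal.ofReal_inv_of_pos (ENNReal.toReal_pos hK0 hKtop), ENNReal.ofReal_toReal hKtop, mul_pow]
  have h1 : ‖∫ z in K, g z‖ₑ ≤ ∫⁻ z in K, ‖g z‖ₑ := enorm_integral_le_lintegral_enorm _
  have h2 := sq_lintegral_le (volume.restrict K) hg.enorm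
  rw [Measure.restrict_apply_univ] at h2
  calc (volume K)⁻¹ ^ 2 * ‖∫ z in K, g z‖ₑ ^ 2
      ≤ (volume K)⁻¹ ^ 2 * (∫⁻ z in K, ‖g z‖ₑ) ^ 2 := by gcongr
    _ ≤ (volume K)⁻¹ ^ 2 * (volume K * ∫⁻ z in K, ‖g z‖ₑ ^ 2) := by gcongr
    _ = (volume K)⁻¹ * ∫⁻ z in K, ‖g z‖ₑ ^ 2 := by
        rw [sq, mul_assoc, ← mul_assoc (volume K)⁻¹ (volume K), ENNReal.inv_mul_cancel hK0 hKtop,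
          one_mul]

/-- Algebra of the average: `f(x) - A_ρ f(x) = |B̄_ρ|⁻¹ ∫_{B̄(0,ρ)} (f(x) - f(x+z)) dz`. -/
theorem sub_ballAvg_eq {f : (EuclideanSpace ℝ (Fin 3)) → (EuclideanSpace ℝ (Fin 3))} (hf : Continuous f)
    (x : EuclideanSpace ℝ (Fin 3)) {ρ : ℝ} (hρ : 0 < ρ) :
    f x - (volume (closedBall (0 : EuclideanSpace ℝ (Fin 3)) ρ)).toReal⁻¹ •
        ∫ z in closedBall (0 : EuclideanSpace ℝ (Fin 3)) ρ, f (x + z) =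
      (volume (closedBall (0 : EuclideanSpace ℝ (Fin 3)) ρ)).toReal⁻¹ •
        ∫ z in closedBall (0 : EuclideanSpace ℝ (Fin 3)) ρ, (f x - f (x + z)) := by
  have hvol : (volume (closedBall (0 : EuclideanSpace ℝ (Fin 3)) ρ)).toReal ≠ 0 :=
    (ENNReal.toReal_pos (volume_closedBall_ne_zero 0 hρ) measure_closedBall_lt_top.ne).ne'
  have hint : IntegrableOn (fun z => f (x + z)) (closedBall (0 : EuclideanSpace ℝ (Fin 3)) ρ) volume :=
    (hf.comp (continuous_const.add continuous_id)).continuousOn.integrableOn_compact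
      (isCompact_closedBall _ _)
  have hconst : IntegrableOn (fun _ : EuclideanSpace ℝ (Fin 3) => f x)
      (closedBall (0 : EuclideanSpace ℝ (Fin 3)) ρ) volume :=
    integrableOn_const (measure_closedBall_lt_top.ne) (by simp)
  rw [integral_sub hconst.integrable hint.integrable, setIntegral_const,
    measureReal_def, smul_sub, ← mul_smul, inv_mul_cancel₀ hvol, one_smul]

/-- **High part**: `‖f(x) - A_ρ f(x)‖² ≤ |B̄_ρ|⁻¹ ∫_{B̄(0,ρ)} ‖f(x+z) - f(x)‖² dz`. -/
theorem enorm_sub_ballAvg_sq_le {f : (EuclideanSpace ℝ (Fin 3)) → (EuclideanSpace ℝ (Fin 3))} (hf : Continuous f)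
    (x : EuclideanSpace ℝ (Fin 3)) {ρ : ℝ} (hρ : 0 < ρ) :
    ‖f x - (volume (closedBall (0 : EuclideanSpace ℝ (Fin 3)) ρ)).toReal⁻¹ •
        ∫ z in closedBall (0 : EuclideanSpace ℝ (Fin 3)) ρ, f (x + z)‖ₑ ^ 2 ≤
      (volume (closedBall (0 : EuclideanSpace ℝ (Fin 3)) ρ))⁻¹ *
        ∫⁻ z in closedBall (0 : EuclideanSpace ℝ (Fin 3)) ρ, ‖f (x + z) - f x‖ₑ ^ 2 := by
  rw [sub_ballAvg_eq hf x hρ]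
  have hg : AEMeasurable (fun z => f x - f (x + z))
      (volume.restrict (closedBall (0 : EuclideanSpace ℝ (Fin 3)) ρ)) := by
    fun_prop
  refine (enorm_avg_sq_le (volume_closedBall_ne_zero 0 hρ) measure_closedBall_lt_top.ne hg).trans
    (le_of_eq ?_)
  congr 1
  exact lintegral_congr fun z => by rw [enorm_sub_rev]

/-- **High part in `L²`**: `‖f - A_ρ f‖₂² ≤ ρ² ‖∇f‖₂²`. -/
theorem lintegral_enorm_sub_ballAvg_sq_le {f : (EuclideanSpace ℝ (Fin 3)) → (EuclideanSpace ℝ (Fin 3))}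
    (hf : ContDiff ℝ 1 f) {ρ : ℝ} (hρ : 0 < ρ) :
    ∫⁻ x, ‖f x - (volume (closedBall (0 : EuclideanSpace ℝ (Fin 3)) ρ)).toReal⁻¹ •
        ∫ z in closedBall (0 : EuclideanSpace ℝ (Fin 3)) ρ, f (x + z)‖ₑ ^ 2 ≤
      ENNReal.ofReal (ρ ^ 2) * ∫⁻ x, ‖fderiv ℝ f x‖ₑ ^ 2 := by
  set K : Set (EuclideanSpace ℝ (Fin 3)) := closedBall 0 ρ with hK
  have hK0 : volume K ≠ 0 := volume_closedBall_ne_zero 0 hρ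
  have hKtop : volume K ≠ ⊤ := measure_closedBall_lt_top.ne
  have hfc : Continuous f := hf.continuous
  have hcont : Continuous fun p : (EuclideanSpace ℝ (Fin 3)) × (EuclideanSpace ℝ (Fin 3)) =>
      f (p.1 + p.2) - f p.1 := by fun_prop
  have hswap : ∫⁻ x, ∫⁻ z in K, ‖f (x + z) - f x‖ₑ ^ 2 = ∫⁻ z in K, ∫⁻ x, ‖f (x + z) - f x‖ₑ ^ 2 := by
    refine lintegral_lintegral_swap ?_
    exact (hcont.measurable.enorm.pow_const 2).aemeasurable
  set D : ℝ≥0∞ := ∫⁻ x, ‖fderiv ℝ f x‖ₑ ^ 2 with hD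
  calc ∫⁻ x, ‖f x - (volume K).toReal⁻¹ • ∫ z in K, f (x + z)‖ₑ ^ 2
      ≤ ∫⁻ x, (volume K)⁻¹ * ∫⁻ z in K, ‖f (x + z) - f x‖ₑ ^ 2 :=
        lintegral_mono fun x => enorm_sub_ballAvg_sq_le hfc x hρ
    _ = (volume K)⁻¹ * ∫⁻ z in K, ∫⁻ x, ‖f (x + z) - f x‖ₑ ^ 2 := by
        rw [lintegral_const_mul' _ _ (ENNReal.inv_ne_top.2 hK0), hswap]
    _ ≤ (volume K)⁻¹ * ∫⁻ z in K, ENNReal.ofReal (ρ ^ 2) * D := by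
        gcongr (volume K)⁻¹ * ?_
        refine setLIntegral_mono' measurableSet_closedBall fun z hz => ?_
        refine (lintegral_enorm_sub_translate_sq_le hf z).trans ?_
        gcongr
        rw [← ofReal_norm, ← ENNReal.ofReal_pow (norm_nonneg _)]
        exact ENNReal.ofReal_le_ofReal (pow_le_pow_left₀ (norm_nonneg _) (mem_closedBall_zero_iff.1 hz) 2)
    _ = ENNReal.ofReal (ρ ^ 2) * D := by
        rw [setLIntegral_const, ← mul_assoc, mul_comm (volume K)⁻¹, mul_assoc, mul_assoc,
          ENNReal.inv_mul_cancel hK0 hKtop, mul_one]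

/-- **Low part**: `‖A_ρ f(x)‖² ≤ |B̄_ρ|⁻¹ ∫_{B̄(x,ρ)} ‖f‖²`. -/
theorem enorm_ballAvg_sq_le {f : (EuclideanSpace ℝ (Fin 3)) → (EuclideanSpace ℝ (Fin 3))} (hf : Continuous f)
    (x : EuclideanSpace ℝ (Fin 3)) {ρ : ℝ} (hρ : 0 < ρ) :
    ‖(volume (closedBall (0 : EuclideanSpace ℝ (Fin 3)) ρ)).toReal⁻¹ •
        ∫ z in closedBall (0 : EuclideanSpace ℝ (Fin 3)) ρ, f (x + z)‖ₑ ^ 2 ≤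
      (volume (closedBall (0 : EuclideanSpace ℝ (Fin 3)) ρ))⁻¹ * ∫⁻ y in closedBall x ρ, ‖f y‖ₑ ^ 2 := by
  have hg : AEMeasurable (fun z => f (x + z))
      (volume.restrict (closedBall (0 : EuclideanSpace ℝ (Fin 3)) ρ)) := by
    fun_prop
  refine (enorm_avg_sq_le (volume_closedBall_ne_zero 0 hρ) measure_closedBall_lt_top.ne hg).trans
    (le_of_eq ?_)
  rw [setLIntegral_closedBall_add_left (fun y => ‖f y‖ₑ ^ 2) x ρ]


end Summit.NavierStokesRegularity.NavierStokesRegularity.Theorems.L3TimeExponentPincerBallAverage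

end
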